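import Summits.QuantumFields.YangMills.Theses.TypicalExteriorCeilings
import Summits.QuantumFields.YangMills.Theorems.TypicalExteriorCeilingsAnnealedBoundaryLawGaussianRung
import HarnessLib

/-!
# Crux `AnnealedBoundaryLaw` (stmt-QuantumFields-25891; split V = `VarianceBoundaryLaw` stmt-25920 / M = `MomentComparability` stmt-25921)
# — Lines/rung.lean: BC5 FIRST RUNG α, the lattice-Gaussian / free-Maxwell instance with `κ = 1`, LANDED (no stubs)

Tribunal-w seat `ym-tec-bc5w-1` (g0).  HONEST FRAMING: the Yang–Mills mass gap is NOT proved; the route's leaf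
`InfiniteVolumeContinuum.HypercubicOSDataFromInfiniteVolume` (stmt-19868), `BalabanLadder.NT`, and the cruxes K1 / V / M (statements about
the SU(2) Wilson state on the torus under live sub-onset floors) are NOT proved and not claimed.  No prover is seated on TEC by this file.

The three Props below are the free-field TRANSPLANTS of the CONCLUSIONS of V / M / K1 under the dictionary of the tree's `UVSeamRec`
Gaussian-calibration series: torus Wilson state ↦ lattice GFF `ν` of `ℤ⁴` (`IsDiscreteGFF ν (coordProc 4)`); `plane_q(x)` ↦ `(φ_{x+e_j} − φ_x)²`;
`kerE` over the cube of side `2R+3` centred at `x` ↦ the conditional expectation `ν[ · | σ(φ_w : w ∉ x + sbox(R+1))]`; `torusE` ↦ `∫ · dν`.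
The floors prefix is dropped (the truncated three-point floor `ε ≤ |Q3|` is identically false-or-vacuous in a Gaussian model, `Q3 ≡ 0`), which
makes the rung STRONGER than a literal instance: unconditional in `R ≥ 1`, `x`, `j`, `p ≥ 1`.  M and K1 demand `κ = 1` explicitly.
All three are PROVED (`rung_V`, `rung_M`, `rung_K1`) from the landed Theorems files
`TypicalExteriorCeilingsAnnealedBoundaryLawWickSquare` (p612596) / `…GaussianRung` (p613337), and the model is non-vacuous (`rung_nonvacuous`).
The V-rate is moreover ATTAINED in the model (`rung_V_sharp`: `(c/R⁴)² ≤ ∫|Z|²` for `R ≥ R₀`).  Line card: `Lines/rung.md`.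
-/

set_option autoImplicit false

noncomputable section

open MeasureTheory
open Literature.Probability.LatticeModels
open Literature.MathematicalPhysics.QuantumFieldTheory.LatticeForm (e)
open Summit.QuantumFields.YangMills.Theorems.WeakCouplingRates.HarmonicInterior
open Summit.QuantumFields.YangMills.Cruxes.AnnealedBoundaryLaw.GaussianRung

namespace Summit.QuantumFields.YangMills.Cruxes.AnnealedBoundaryLaw.Rung

/-- RUNG α / V: free-field transplant of the conclusion of `TypicalExteriorCeilings.VarianceBoundaryLaw` (stmt-25920):
`∃ C ≥ 0, ∀ R ≥ 1, ∀ j x, ∫ |ν[(∇_jφ(x))² | exterior] − ∫(∇_jφ(x))²|² dν ≤ (C/R⁴)²`, for every lattice GFF `ν` of `ℤ⁴`. -/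
def VarianceBoundaryLawFreeField : Prop :=
  ∀ ν : Measure (Site 4 → ℝ), IsDiscreteGFF ν (coordProc 4) →
    ∃ C : ℝ, 0 ≤ C ∧ ∀ (R : ℕ), 1 ≤ R → ∀ (j : Fin 4) (x : Site 4),
      ∫ φ, |(ν[fun φ' : Site 4 → ℝ => (φ' (x + e j) - φ' x) ^ 2 |
              MeasurableSpace.comap (fun (φ' : Site 4 → ℝ) (w : {w : Site 4 // w ∉ (sbox (R + 1)).image (fun z => x + z)}) => φ' w)
                inferInstance]) φ - ∫ φ', (φ' (x + e j) - φ' x) ^ 2 ∂ν| ^ 2 ∂ν ≤ (C / (R : ℝ) ^ 4) ^ 2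

/-- RUNG α / M: free-field transplant of the conclusion of `TypicalExteriorCeilings.MomentComparability` (stmt-25921) WITH `κ = 1`:
`∃ C κ, 0 ≤ C ∧ 0 ≤ κ ∧ κ = 1 ∧ ∀ R j x, ∀ p ≥ 1, (∫|Z|^p dν)² ≤ (C·p^κ)^{2p} (∫|Z|² dν)^p`. -/
def MomentComparabilityFreeField : Prop :=
  ∀ ν : Measure (Site 4 → ℝ), IsDiscreteGFF ν (coordProc 4) →
    ∃ C κ : ℝ, 0 ≤ C ∧ 0 ≤ κ ∧ κ = 1 ∧ ∀ (R : ℕ) (j : Fin 4) (x : Site 4) (p : ℕ), 1 ≤ p →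
      (∫ φ, |(ν[fun φ' : Site 4 → ℝ => (φ' (x + e j) - φ' x) ^ 2 |
              MeasurableSpace.comap (fun (φ' : Site 4 → ℝ) (w : {w : Site 4 // w ∉ (sbox (R + 1)).image (fun z => x + z)}) => φ' w)
                inferInstance]) φ - ∫ φ', (φ' (x + e j) - φ' x) ^ 2 ∂ν| ^ p ∂ν) ^ 2 ≤
        (C * (p : ℝ) ^ κ) ^ (2 * p) *
          (∫ φ, |(ν[fun φ' : Site 4 → ℝ => (φ' (x + e j) - φ' x) ^ 2 |
              MeasurableSpace.comap (fun (φ' : Site 4 → ℝ) (w : {w : Site 4 // w ∉ (sbox (R + 1)).image (fun z => x + z)}) => φ' w)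
                inferInstance]) φ - ∫ φ', (φ' (x + e j) - φ' x) ^ 2 ∂ν| ^ 2 ∂ν) ^ p

/-- RUNG α / K1: free-field transplant of the conclusion of `TypicalExteriorCeilings.AnnealedBoundaryLaw` (stmt-25891) WITH `κ = 1`:
`∃ C κ, 0 ≤ C ∧ 0 ≤ κ ∧ κ = 1 ∧ ∀ R ≥ 1, ∀ j x, ∀ p ≥ 1, ∫|Z|^p dν ≤ (C·p^κ/R⁴)^p`. -/
def AnnealedBoundaryLawFreeField : Prop :=
  ∀ ν : Measure (Site 4 → ℝ), IsDiscreteGFF ν (coordProc 4) →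
    ∃ C κ : ℝ, 0 ≤ C ∧ 0 ≤ κ ∧ κ = 1 ∧ ∀ (R : ℕ), 1 ≤ R → ∀ (j : Fin 4) (x : Site 4) (p : ℕ), 1 ≤ p →
      ∫ φ, |(ν[fun φ' : Site 4 → ℝ => (φ' (x + e j) - φ' x) ^ 2 |
              MeasurableSpace.comap (fun (φ' : Site 4 → ℝ) (w : {w : Site 4 // w ∉ (sbox (R + 1)).image (fun z => x + z)}) => φ' w)
                inferInstance]) φ - ∫ φ', (φ' (x + e j) - φ' x) ^ 2 ∂ν| ^ p ∂ν ≤ (C * (p : ℝ) ^ κ / (R : ℝ) ^ 4) ^ p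

/-- RUNG α / V holds (landed `gff_varianceBoundaryLaw_condExp`). -/
theorem rung_V : VarianceBoundaryLawFreeField := fun _ hν => gff_varianceBoundaryLaw_condExp hν

/-- RUNG α / V is SHARP in the model: the rate `R⁻⁸` is attained (landed `rung_varianceBoundaryLaw_freeField`). -/
theorem rung_V_sharp : ∀ ν : Measure (Site 4 → ℝ), IsDiscreteGFF ν (coordProc 4) →
    ∃ c : ℝ, 0 < c ∧ ∃ R₀ : ℕ, ∀ (R : ℕ), R₀ ≤ R → 1 ≤ R → ∀ (j : Fin 4) (x : Site 4),
      (c / (R : ℝ) ^ 4) ^ 2 ≤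
        ∫ φ, |(ν[fun φ' : Site 4 → ℝ => (φ' (x + e j) - φ' x) ^ 2 |
              MeasurableSpace.comap (fun (φ' : Site 4 → ℝ) (w : {w : Site 4 // w ∉ (sbox (R + 1)).image (fun z => x + z)}) => φ' w)
                inferInstance]) φ - ∫ φ', (φ' (x + e j) - φ' x) ^ 2 ∂ν| ^ 2 ∂ν :=
  fun _ hν => (rung_varianceBoundaryLaw_freeField hν).2

/-- RUNG α / M holds with `κ = 1` (landed `rung_momentComparability_freeField`). -/
theorem rung_M : MomentComparabilityFreeField := fun _ hν => rung_momentComparability_freeField hν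

/-- RUNG α / K1 holds with `κ = 1` (landed `rung_annealedBoundaryLaw_freeField`). -/
theorem rung_K1 : AnnealedBoundaryLawFreeField := fun _ hν => rung_annealedBoundaryLaw_freeField hν

/-- The model is non-vacuous: a lattice GFF of `ℤ⁴` exists (landed `exists_isDiscreteGFF_four`). -/
theorem rung_nonvacuous : ∃ ν : Measure (Site 4 → ℝ), IsDiscreteGFF ν (coordProc 4) := exists_isDiscreteGFF_four

/-- The rung, packaged: V ∧ M(κ = 1) ∧ K1(κ = 1) in the free field, and the free field exists. -/
theorem rung_alpha : VarianceBoundaryLawFreeField ∧ MomentComparabilityFreeField ∧ AnnealedBoundaryLawFreeField ∧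
    ∃ ν : Measure (Site 4 → ℝ), IsDiscreteGFF ν (coordProc 4) :=
  ⟨rung_V, rung_M, rung_K1, rung_nonvacuous⟩

end Summit.QuantumFields.YangMills.Cruxes.AnnealedBoundaryLaw.Rung

end
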